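import Literature.MathematicalPhysics.QuantumFieldTheory.Balaban1983to89.B11Eq117LetterDefectsTwoBackgrounds
import Literature.MathematicalPhysics.QuantumFieldTheory.Balaban1983to89.B11Eq120SolutionContinuity
import Literature.MathematicalPhysics.QuantumFieldTheory.Balaban1983to89.B11Eq44COperatorTorus

/-!
# `Balaban1983to89.B11Eq174ChartContinuityTwoBackgrounds` — T. Bałaban, *The variational problem and background fields in renormalization group method
# for lattice gauge theories*, Commun. Math. Phys. **102** (1985) 277–309 [Balaban1985Variational] Prop. 6 (116)–(121) p. 295, (174)–(175) p. 305, Prop. 9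
# p. 309, with [Balaban1985BackgroundPropagators] Thm 3.4 p. 400: THE CONFIGURATION `𝒜_U(H₁(U)B) + H₁(U)B` OF THE CHART (174) AT THE NE9 CHAIN'S LETTERS
# IS LIPSCHITZ IN THE BACKGROUND BETWEEN TWO SMALL-BOND BACKGROUNDS `U`, `U′`, AT A FIXED LATTICE — read from `Space115 … (∇_U)` into `Space115 … (∇_{U′})`
# through the jet identity: `‖ι(𝒜_U + H₁(U)B) − (𝒜_{U′} + H₁(U′)B)‖ ≤ (K_G δ (j + C₄(ε₄+a)²) + B₀′δ_W + K_A δ‖B‖)∕(1 − κ₂)` (`‖U(b) − U′(b)‖ ≤ δ`) modulo the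
# (L3) slot's own modulus `δ_W`; and the same for the full chart (174)∘(47) with the Sect. C slot, modulo `δ_W`, `δ_C`

statement-level skeleton of published theorems with citation tags; proofs where landed; nothing here is a claim about the Yang–Mills mass gap

PDF held: `paper:balaban1985-cmp102-variational-background` p. 295 Prop. 6, p. 305 (174)–(175), p. 309 Prop. 9; `paper:balaban1985-cmp99-background-propagators`
p. 400 Thm 3.4 — through the verbatim quotations of `B11Eq174ChartContinuityAtFlat` (NE9 owner gen 82), whose two theorems this file runs a second time
between two backgrounds.  Print proves analyticity in `𝔄`∕`B` at a fixed background and analyticity of the LETTERS in the background; the continuity of the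
chart's configuration between two backgrounds is the cell's fixed-lattice composition of the two.

CITATION HEADER (lean-in-tree rule 2026-08-18).  Audit cell `pub-balaban`, sub-cell `t4`, NE9 crux team (2): LEAF PROVER 04
(`b2b-balaban-t4-ne9-formalise-leaf-04` gen 73) — the TWO-BACKGROUND twin of the NE9 owner's (B″) `B11Eq174ChartContinuityAtFlat` (gen 82), the top
junction above this lineage's two-background letters for the owner's census item (i) «two general small fields» (journal `CLAIMS.log` l.42142): inputs
(B′)₂ `B11Eq117LetterDefectsTwoBackgrounds.exists_letter_defects_twoBackgrounds` ∕ `norm_jetId_nabla_twoBackgrounds_le` and the owner's ABSTRACT two-carrier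
comparison `B11Eq120SolutionContinuity.norm_map_arg_sub_arg_le` ∕ `norm_map_chartHB_sectC_sub_le` BY NAME.

WHAT IS PROVED (sorry-free; composition; 0 def; no inequality of the paper asserted).
* **`exists_chart_arg_lipschitz_twoBackgrounds`** — `∃ K_G K_A K_ι ε₉ > 0 ∀ U U′` (E162 data at both, `‖U(b) − 1‖, ‖U′(b) − 1‖ ≤ ε ≤ ε₉`, `‖U(b) − U′(b)‖ ≤ δ`,
  `hRS`, `hRS′`) `∀ hpos hQ hpos′ hQ′`, for ALL (L3) slots `W_U`, `W_{U′}`, regimes `R_U`, `R_{U′}`, block fields `B` with `‖H₁(U)B‖ < a`, `‖H₁(U′)B‖ < a′`,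
  a modulus `‖W_U P − W_{U′}(ιP)‖ ≤ δ_W` on `‖P‖ < ε₄ + a`, radii `(1 + K_ι δ)(ε₄ + a) ≤ ρ`, `ε₄′ + a′ ≤ ρ`, `s > 0`, `2(ρ + s) ≤ a₃′`, `κ₂ < 1`:
  `‖ι(𝒜_U(H₁(U)B) + H₁(U)B) − (𝒜_{U′}(H₁(U′)B) + H₁(U′)B)‖_(115),∇_{U′} ≤ (K_G·δ·(j + C₄(ε₄ + a)²) + B₀′δ_W + K_A·δ·‖B‖)∕(1 − κ₂)`.
* **`exists_chartHB_lipschitz_twoBackgrounds`** — the FULL chart (174)∘(47) with the Sect. C T-slot: `‖ι(chartHB_U B) − chartHB_{U′} B‖ ≤ (…)∕((1 − κ₂)(1 − κ_C))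
  + (K_A δ C₂(ε_C + a_C)² + b′δ_C)∕(1 − κ_C)`, the `C(U)`-letter's modulus `δ_C` and the Sect. C regimes DISPLAYED.
MODEL / HONEST SCOPE.  As `B11Eq174ChartContinuityAtFlat`: the one-level periodic model of `B9Eq315QTorus`; every constant a finite-lattice number (level maps'
extreme weights, `#bonds`, `c₀`, `c₁`, `M_φ`, `M_φ′`, `C_τ`); both backgrounds in the small-bond ball; the moduli `δ_W` of the (L3) slot and `δ_C` of the
Sect. C letter DISPLAYED, not produced; NOT print's uniformity in the lattice, NOT analyticity in `A`; the two-background chart comparison of the species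
`cur U` ∕ `cur U′` ((Z)₂, a `T4Continuum/Support` statement) is NOT here — FREEZE (0) — its Literature ingredients are; NOT summit progress (cell pub-balaban:
NE9 NOT PRINTED ∕ NOT PROVED; spine PROVED 0∕9; rung (B)+1 finite T⁴ — NOT infinite volume, NOT mass gap, NOT BetaPertH, NOT Clay).  NEW file importing
`B11Eq117LetterDefectsTwoBackgrounds`, `B11Eq120SolutionContinuity`, `B11Eq44COperatorTorus`; nothing of the NE9-owner lineage's files is modified.
Net new unproved facts: 0.
-/

noncomputable section

namespace Literature.MathematicalPhysics.QuantumFieldTheory.Balaban1983to89.B11Eq174ChartContinuityTwoBackgrounds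

open scoped InnerProductSpace
open Metric Set
open B11Eq115Space B11Eq111FrakG B11Eq103H1Complex
open B13Contraction113 (QuadAnalytic)
open B11Eq174Chart (Regime solA)
open B9SectCLatticeCarrier (Bond)
open B4Sect5Torus (TSite)
open B7Prop1Explicit (U1 Wcx boxVec)
open B9Eq319QprimeTorus (fineP)
open B9Eq310HessianOperator (adTransportW hessOp)
open B9Eq315QTorus (perCfg cornerSite QtorusW laplaceAofBackground)
open B9Eq315QTorusOnto (liftSite perSite_liftSite)
open B11Eq117LetterDefectsTwoBackgrounds (norm_jetId_nabla_twoBackgrounds_le exists_letter_defects_twoBackgrounds)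
open B11Eq120SolutionContinuity (norm_map_arg_sub_arg_le norm_map_chartHB_sectC_sub_le)
open B11Eq44COperatorTorus (Cc)
open B11Eq174Chart (chartHB)

variable {d : ℕ} (L : ℕ) [NeZero L] (m : Fin d → ℕ) [∀ i, NeZero (fineP L m i)] (hL : 1 ≤ L)
  {𝔸 : Type*} [NormedRing 𝔸] [NormedAlgebra ℂ 𝔸] [CompleteSpace 𝔸] [NormOneClass 𝔸] [StarRing 𝔸] [NormedStarGroup 𝔸] [StarModule ℂ 𝔸]
  [FiniteDimensional ℂ 𝔸]
  {W : Type*} [NormedAddCommGroup W] [InnerProductSpace ℂ W] [FiniteDimensional ℂ W] (φ : W ≃ₗ[ℂ] 𝔸) {c₀ c₁ : ℝ} [Fact (0 < c₀)] [Fact (0 < c₁)]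

set_option maxHeartbeats 800000 in
set_option maxRecDepth 8192 in
/-- **THE CONFIGURATION OF THE CHART (174) AT THE CHAIN'S LETTERS IS LIPSCHITZ IN THE BACKGROUND BETWEEN TWO SMALL-BOND BACKGROUNDS (fixed lattice,
`Λ := 0`, `J := 0` face)** — `‖ι(𝒜_U(H₁(U)B) + H₁(U)B) − (𝒜_{U′}(H₁(U′)B) + H₁(U′)B)‖_(115),∇_{U′} ≤ (K_G·δ·(j + C₄(ε₄ + a)²) + B₀′δ_W + K_A·δ·‖B‖)∕(1 − κ₂)`
for `‖U(b) − U′(b)‖ ≤ δ`, both backgrounds `ε ≤ ε₉`-close to `1`: the defects `K_ι = 1 + K_ι⁰δ`, `δ_G = K_Gδ`, `δ_A = K_Aδ‖B‖` PRODUCED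
(`B11Eq117LetterDefectsTwoBackgrounds`), the W-slot modulus `δ_W` and the scalar regime letters DISPLAYED; composition by the NE9 owner's
`B11Eq120SolutionContinuity.norm_map_arg_sub_arg_le` — his `B11Eq174ChartContinuityAtFlat.exists_chart_arg_lipschitz_at_flat` with `U′` for `1`.
[cite: Balaban1985Variational, Prop. 6 (116)–(121) p.295, (174)–(175) p.305, Prop. 9 p.309; Balaban1985BackgroundPropagators, Thm 3.4 p.400, (3.86) p.407] -/
theorem exists_chart_arg_lipschitz_twoBackgrounds {η : ℝ} [Fact (0 < (L : ℝ))] [Fact (0 < η)] (lev₀ : Bond d (fineP L m) → ℕ) (levB : Bond d m → ℕ)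
    (lev₁ : Bond d (fineP L m) × Fin d → ℕ) {a₀ : ℝ} (ha₀ : 0 < a₀) {Mφ Mφ' : ℝ} (hMφ : 0 ≤ Mφ) (hMφ' : 0 ≤ Mφ')
    (hφ : ∀ w, ‖φ w‖ ≤ Mφ * ‖w‖) (hφ' : ∀ X, ‖φ.symm X‖ ≤ Mφ' * ‖X‖) (τ : 𝔸 →ₗ[ℂ] ℂ) {Cτ : ℝ} (hτ : ∀ X, ‖τ X‖ ≤ Cτ * ‖X‖) (hCτ : 0 ≤ Cτ) :
    ∃ KG KA Kι ε₉ : ℝ, 0 < KG ∧ 0 < KA ∧ 0 < Kι ∧ 0 < ε₉ ∧ ∀ (U U' : Bond d (fineP L m) → 𝔸ˣ) {α α' : ℝ} (hα1 : α ≤ 1 / 64)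
      (hU1 : ∀ (x : B7Prop1Explicit.Site d) (κ : Fin d), perCfg (fineP L m) U x κ ∈ U1 𝔸)
      (hreg : ∀ (y : TSite d m) (κ : Fin d) (r : Fin d → Fin L), ‖((Wcx L (perCfg (fineP L m) U) (cornerSite L y) κ (boxVec L r) : 𝔸ˣ) : 𝔸) - 1‖ ≤ α)
      (hα1' : α' ≤ 1 / 64)
      (hU1' : ∀ (x : B7Prop1Explicit.Site d) (κ : Fin d), perCfg (fineP L m) U' x κ ∈ U1 𝔸)
      (hreg' : ∀ (y : TSite d m) (κ : Fin d) (r : Fin d → Fin L), ‖((Wcx L (perCfg (fineP L m) U') (cornerSite L y) κ (boxVec L r) : 𝔸ˣ) : 𝔸) - 1‖ ≤ α')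
      {ε δ : ℝ}, 0 ≤ ε → ε ≤ ε₉ → 0 ≤ δ → (∀ b, ‖(U b : 𝔸) - 1‖ ≤ ε) → (∀ b, ‖(U' b : 𝔸) - 1‖ ≤ ε) →
      (∀ b, ‖(U b : 𝔸) - (U' b : 𝔸)‖ ≤ δ) →
      (∀ (b : Bond d (fineP L m)) (v u : W), ⟪adTransportW φ U b v, u⟫_ℂ = ⟪v, adTransportW φ (fun b => (U b)⁻¹) b u⟫_ℂ) →
      (∀ (b : Bond d (fineP L m)) (v u : W), ⟪adTransportW φ U' b v, u⟫_ℂ = ⟪v, adTransportW φ (fun b => (U' b)⁻¹) b u⟫_ℂ) →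
      ∀ (hpos : ∀ x : BondL2K ℂ d (fineP L m) c₀ W, x ≠ 0 →
          0 < RCLike.re ⟪x, laplaceAofBackground L m hL φ U hα1 hU1 hreg τ η (c₀ := c₀) (c₁ := c₁) a₀ x⟫_ℂ)
        (hQ : Function.Surjective (QtorusW L m hL φ U hα1 hU1 hreg (c₀ := c₀) (c₁ := c₁)))
        (hpos' : ∀ x : BondL2K ℂ d (fineP L m) c₀ W, x ≠ 0 →
          0 < RCLike.re ⟪x, laplaceAofBackground L m hL φ U' hα1' hU1' hreg' τ η (c₀ := c₀) (c₁ := c₁) a₀ x⟫_ℂ)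
        (hQ' : Function.Surjective (QtorusW L m hL φ U' hα1' hU1' hreg' (c₀ := c₀) (c₁ := c₁)))
        {W₁ : Space115 (L : ℝ) η lev₀ lev₁ (nabla115 η U) → NegSize (L : ℝ) η lev₀ 3 𝔸}
        {W₂ : Space115 (L : ℝ) η lev₀ lev₁ (nabla115 η U') → NegSize (L : ℝ) η lev₀ 3 𝔸}
        {B₀ θ C₄ a₃ j a ε₄ B₀' θ' C₄' a₃' j' a' ε₄' δW ρ s : ℝ}
        (_R₁ : Regime (frakGLatticeCLM (L := (L : ℝ)) (η := η) (lev₀ := lev₀) φ hpos hQ lev₁ (nabla115 η U)) 0 W₁ B₀ θ C₄ a₃ j a ε₄)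
        (_R₂ : Regime (frakGLatticeCLM (L := (L : ℝ)) (η := η) (lev₀ := lev₀) (Δ₁ := hessOp φ η U' τ)
          (Q := QtorusW L m hL φ U' hα1' hU1' hreg' (c₀ := c₀) (c₁ := c₁))
          φ hpos' hQ' lev₁ (nabla115 η U')) 0 W₂ B₀' θ' C₄' a₃' j' a' ε₄')
        (_hj : 0 ≤ j) (_hj' : 0 ≤ j') (B : NegSize (L : ℝ) η levB 0 𝔸)
        (_hB : ‖H1LatticeCLM (L := (L : ℝ)) (η := η) (lev₀ := lev₀) (levB := levB) φ hpos hQ lev₁ (nabla115 η U) B‖ < a)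
        (_hB' : ‖H1LatticeCLM (L := (L : ℝ)) (η := η) (lev₀ := lev₀) (levB := levB) (Δ₁ := hessOp φ η U' τ)
          (Q := QtorusW L m hL φ U' hα1' hU1' hreg' (c₀ := c₀) (c₁ := c₁))
          φ hpos' hQ' lev₁ (nabla115 η U') B‖ < a')
        (_hδW : ∀ P : Space115 (L : ℝ) η lev₀ lev₁ (nabla115 η U), ‖P‖ < ε₄ + a →
          ‖W₁ P - W₂ (LinearMap.toContinuousLinearMap
            ((jetLinearEquiv (L : ℝ) η lev₀ lev₁ (nabla115 η U')).symm.toLinearMap ∘ₗ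
              (jetLinearEquiv (L : ℝ) η lev₀ lev₁ (nabla115 η U)).toLinearMap) P)‖ ≤ δW)
        (_hρ₁ : (1 + Kι * δ) * (ε₄ + a) ≤ ρ) (_hρ₂ : ε₄' + a' ≤ ρ) (_hs : 0 < s) (_hdom : 2 * (ρ + s) ≤ a₃')
        (_hκ : θ' + 4 * B₀' * C₄' * (ρ + s) < 1),
      ‖LinearMap.toContinuousLinearMap
            ((jetLinearEquiv (L : ℝ) η lev₀ lev₁ (nabla115 η U')).symm.toLinearMap ∘ₗ
              (jetLinearEquiv (L : ℝ) η lev₀ lev₁ (nabla115 η U)).toLinearMap)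
          (solA (frakGLatticeCLM (L := (L : ℝ)) (η := η) (lev₀ := lev₀) φ hpos hQ lev₁ (nabla115 η U)) 0 W₁ 0 ε₄
              (H1LatticeCLM (L := (L : ℝ)) (η := η) (lev₀ := lev₀) (levB := levB) φ hpos hQ lev₁ (nabla115 η U) B) +
            H1LatticeCLM (L := (L : ℝ)) (η := η) (lev₀ := lev₀) (levB := levB) φ hpos hQ lev₁ (nabla115 η U) B) -
        (solA (frakGLatticeCLM (L := (L : ℝ)) (η := η) (lev₀ := lev₀) (Δ₁ := hessOp φ η U' τ)
              (Q := QtorusW L m hL φ U' hα1' hU1' hreg' (c₀ := c₀) (c₁ := c₁))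
              φ hpos' hQ' lev₁ (nabla115 η U')) 0 W₂ 0 ε₄'
            (H1LatticeCLM (L := (L : ℝ)) (η := η) (lev₀ := lev₀) (levB := levB) (Δ₁ := hessOp φ η U' τ)
              (Q := QtorusW L m hL φ U' hα1' hU1' hreg' (c₀ := c₀) (c₁ := c₁))
              φ hpos' hQ' lev₁ (nabla115 η U') B) +
          H1LatticeCLM (L := (L : ℝ)) (η := η) (lev₀ := lev₀) (levB := levB) (Δ₁ := hessOp φ η U' τ)
            (Q := QtorusW L m hL φ U' hα1' hU1' hreg' (c₀ := c₀) (c₁ := c₁))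
            φ hpos' hQ' lev₁ (nabla115 η U') B)‖ ≤
        (KG * δ * (j + C₄ * (ε₄ + a) ^ 2) + B₀' * δW + KA * δ * ‖B‖) / (1 - (θ' + 4 * B₀' * C₄' * (ρ + s))) := by
  obtain ⟨KG, KA, ε₉, hKG, hKA, hε₉, H⟩ :=
    exists_letter_defects_twoBackgrounds L m hL φ (c₀ := c₀) (c₁ := c₁) (η := η) lev₀ levB lev₁ ha₀ hMφ hMφ' hφ hφ' τ hτ hCτ
  -- the slope of the jet identity's bound: `‖ι‖ ≤ 1 + Kι·δ`
  obtain ⟨Kι, hKιdef⟩ : ∃ Kι : ℝ, Kι = (NegSup.wSup (levWeight (L : ℝ) η lev₁ 2) : ℝ) * (2 * ‖((η : ℂ))⁻¹‖) *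
      NegSup.wInvSup (levWeight (L : ℝ) η lev₀ 1) + 1 := ⟨_, rfl⟩
  have hKι : 0 < Kι := by rw [hKιdef]; positivity
  refine ⟨KG, KA, Kι, ε₉, hKG, hKA, hKι, hε₉, ?_⟩
  intro U U' α α' hα1 hU1 hreg hα1' hU1' hreg' ε δ hε hεε₉ hδ hUε hU'ε hUU' hRS hRS' hpos hQ hpos' hQ' W₁ W₂ B₀ θ C₄ a₃ j a ε₄ B₀' θ' C₄' a₃' j' a' ε₄' δW ρ s R₁ R₂ hj hj' B hB hB'
    hδW hρ₁ hρ₂ hs hdom hκ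
  obtain ⟨HG, HA⟩ := H U U' hα1 hU1 hreg hα1' hU1' hreg' hε hεε₉ hδ hUε hU'ε hUU' hRS hRS' hpos hQ hpos' hQ'
  -- `U(b), U′(b) ∈ U1` read off E162's `hU1`, `hU1′`
  have hUb : ∀ b : Bond d (fineP L m), U b ∈ U1 𝔸 := fun b => by
    obtain ⟨y, κ⟩ := b
    have h := hU1 (liftSite y) κ
    rwa [B9Eq315QTorus.perCfg_apply, perSite_liftSite] at h
  have hU'b : ∀ b : Bond d (fineP L m), U' b ∈ U1 𝔸 := fun b => by
    obtain ⟨y, κ⟩ := b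
    have h := hU1' (liftSite y) κ
    rwa [B9Eq315QTorus.perCfg_apply, perSite_liftSite] at h
  -- the comparison map's bound `‖ι f‖ ≤ (1 + Kι δ)‖f‖`
  have hι : ∀ f : Space115 (L : ℝ) η lev₀ lev₁ (nabla115 η U),
      ‖LinearMap.toContinuousLinearMap
          ((jetLinearEquiv (L : ℝ) η lev₀ lev₁ (nabla115 η U')).symm.toLinearMap ∘ₗ
            (jetLinearEquiv (L : ℝ) η lev₀ lev₁ (nabla115 η U)).toLinearMap) f‖ ≤ (1 + Kι * δ) * ‖f‖ := fun f => by
    refine (norm_jetId_nabla_twoBackgrounds_le L m (η := η) (lev₀ := lev₀) lev₁ U U' hUb hU'b hδ hUU' f).trans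
      (mul_le_mul_of_nonneg_right ?_ (norm_nonneg f))
    rw [hKιdef]
    have h0 : 0 ≤ (NegSup.wSup (levWeight (L : ℝ) η lev₁ 2) : ℝ) * (2 * ‖((η : ℂ))⁻¹‖ * δ) * NegSup.wInvSup (levWeight (L : ℝ) η lev₀ 1) := by
      positivity
    nlinarith [h0, hδ]
  have hJ : ‖(0 : NegSize (L : ℝ) η lev₀ 3 𝔸)‖ ≤ j := by rw [norm_zero]; exact hj
  have hJ' : ‖(0 : NegSize (L : ℝ) η lev₀ 3 𝔸)‖ ≤ j' := by rw [norm_zero]; exact hj'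
  have hδΛ : ∀ y : Space115 (L : ℝ) η lev₀ lev₁ (nabla115 η U),
      ‖LinearMap.toContinuousLinearMap
          ((jetLinearEquiv (L : ℝ) η lev₀ lev₁ (nabla115 η U')).symm.toLinearMap ∘ₗ
            (jetLinearEquiv (L : ℝ) η lev₀ lev₁ (nabla115 η U)).toLinearMap) ((0 : _ →L[ℂ] _) y) -
        (0 : _ →L[ℂ] _) (LinearMap.toContinuousLinearMap
          ((jetLinearEquiv (L : ℝ) η lev₀ lev₁ (nabla115 η U')).symm.toLinearMap ∘ₗ
            (jetLinearEquiv (L : ℝ) η lev₀ lev₁ (nabla115 η U)).toLinearMap) y)‖ ≤ 0 * ‖y‖ := fun y => by simp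
  have h := norm_map_arg_sub_arg_le (J := (0 : NegSize (L : ℝ) η lev₀ 3 𝔸)) R₁ R₂ hJ hJ' hB hB' (by positivity) hι (by positivity) le_rfl
    HG hδΛ hδW (HA B) hρ₁ hρ₂ hs hdom hκ
  refine h.trans (le_of_eq ?_)
  congr 1
  ring


set_option maxHeartbeats 800000 in
set_option maxRecDepth 8192 in
/-- **THE FULL CHART (174)∘(47) OF `cur U` AT THE CHAIN'S LETTERS IS LIPSCHITZ IN THE BACKGROUND BETWEEN TWO SMALL-BOND BACKGROUNDS (fixed lattice)** —
the species' `chartHB 𝔊(U) 0 W 0 (A′ ↦ A′ + solA H₁(U) 0 C(U) 0 ε_C A′) ε₄ H₁(U)` read into the (115) norm at `∇_{U′}` against the chart at `U′`: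
`‖ι(chartHB_U B) − chartHB_{U′} B‖ ≤ (K_G·δ·(j + C₄(ε₄+a)²) + B₀′δ_W + K_A·δ·‖B‖)∕((1 − κ₂)(1 − κ_C)) + (K_A·δ·C₂(ε_C + a_C)² + b′δ_C)∕(1 − κ_C)`,
the letter defects `K_ι, δ_G, δ_A = δ_H` PRODUCED (`B11Eq117LetterDefectsTwoBackgrounds`), the (L3) slot's modulus `δ_W`, the `C(U)`-letter's modulus
`δ_C` (`B11Eq44COperatorTorus.Cc` at `U` against `U′`) and the four regimes' scalar letters DISPLAYED; composition by the NE9 owner's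
`B11Eq120SolutionContinuity.norm_map_chartHB_sectC_sub_le` — his `exists_chartHB_lipschitz_at_flat` with `U′` for `1`.
[cite: Balaban1985Variational, (174)–(175) p.305, (47)–(50) p.285, Prop. 6 (116)–(121) p.295, Prop. 9 p.309; Balaban1985BackgroundPropagators, Thm 3.4 p.400; Balaban1985Averaging, Prop. 7 p.43] -/
theorem exists_chartHB_lipschitz_twoBackgrounds {η : ℝ} [Fact (0 < (L : ℝ))] [Fact (0 < η)] (lev₀ : Bond d (fineP L m) → ℕ) (levB : Bond d m → ℕ)
    (lev₁ : Bond d (fineP L m) × Fin d → ℕ) {a₀ : ℝ} (ha₀ : 0 < a₀) {Mφ Mφ' : ℝ} (hMφ : 0 ≤ Mφ) (hMφ' : 0 ≤ Mφ')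
    (hφ : ∀ w, ‖φ w‖ ≤ Mφ * ‖w‖) (hφ' : ∀ X, ‖φ.symm X‖ ≤ Mφ' * ‖X‖) (τ : 𝔸 →ₗ[ℂ] ℂ) {Cτ : ℝ} (hτ : ∀ X, ‖τ X‖ ≤ Cτ * ‖X‖) (hCτ : 0 ≤ Cτ) :
    ∃ KG KA Kι ε₉ : ℝ, 0 < KG ∧ 0 < KA ∧ 0 < Kι ∧ 0 < ε₉ ∧ ∀ (U U' : Bond d (fineP L m) → 𝔸ˣ) {α α' : ℝ} (hα1 : α ≤ 1 / 64)
      (hU1 : ∀ (x : B7Prop1Explicit.Site d) (κ : Fin d), perCfg (fineP L m) U x κ ∈ U1 𝔸)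
      (hreg : ∀ (y : TSite d m) (κ : Fin d) (r : Fin d → Fin L), ‖((Wcx L (perCfg (fineP L m) U) (cornerSite L y) κ (boxVec L r) : 𝔸ˣ) : 𝔸) - 1‖ ≤ α)
      (hα1' : α' ≤ 1 / 64)
      (hU1' : ∀ (x : B7Prop1Explicit.Site d) (κ : Fin d), perCfg (fineP L m) U' x κ ∈ U1 𝔸)
      (hreg' : ∀ (y : TSite d m) (κ : Fin d) (r : Fin d → Fin L), ‖((Wcx L (perCfg (fineP L m) U') (cornerSite L y) κ (boxVec L r) : 𝔸ˣ) : 𝔸) - 1‖ ≤ α')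
      {ε δ : ℝ}, 0 ≤ ε → ε ≤ ε₉ → 0 ≤ δ → (∀ b, ‖(U b : 𝔸) - 1‖ ≤ ε) → (∀ b, ‖(U' b : 𝔸) - 1‖ ≤ ε) →
      (∀ b, ‖(U b : 𝔸) - (U' b : 𝔸)‖ ≤ δ) →
      (∀ (b : Bond d (fineP L m)) (v u : W), ⟪adTransportW φ U b v, u⟫_ℂ = ⟪v, adTransportW φ (fun b => (U b)⁻¹) b u⟫_ℂ) →
      (∀ (b : Bond d (fineP L m)) (v u : W), ⟪adTransportW φ U' b v, u⟫_ℂ = ⟪v, adTransportW φ (fun b => (U' b)⁻¹) b u⟫_ℂ) →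
      ∀ (hpos : ∀ x : BondL2K ℂ d (fineP L m) c₀ W, x ≠ 0 →
          0 < RCLike.re ⟪x, laplaceAofBackground L m hL φ U hα1 hU1 hreg τ η (c₀ := c₀) (c₁ := c₁) a₀ x⟫_ℂ)
        (hQ : Function.Surjective (QtorusW L m hL φ U hα1 hU1 hreg (c₀ := c₀) (c₁ := c₁)))
        (hpos' : ∀ x : BondL2K ℂ d (fineP L m) c₀ W, x ≠ 0 →
          0 < RCLike.re ⟪x, laplaceAofBackground L m hL φ U' hα1' hU1' hreg' τ η (c₀ := c₀) (c₁ := c₁) a₀ x⟫_ℂ)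
        (hQ' : Function.Surjective (QtorusW L m hL φ U' hα1' hU1' hreg' (c₀ := c₀) (c₁ := c₁)))
        {W₁ : Space115 (L : ℝ) η lev₀ lev₁ (nabla115 η U) → NegSize (L : ℝ) η lev₀ 3 𝔸}
        {W₂ : Space115 (L : ℝ) η lev₀ lev₁ (nabla115 η U') → NegSize (L : ℝ) η lev₀ 3 𝔸}
        {B₀ θ C₄ a₃ j a ε₄ B₀' θ' C₄' a₃' j' a' ε₄' δW ρ s : ℝ}
        (_R₁ : Regime (frakGLatticeCLM (L := (L : ℝ)) (η := η) (lev₀ := lev₀) φ hpos hQ lev₁ (nabla115 η U)) 0 W₁ B₀ θ C₄ a₃ j a ε₄)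
        (_R₂ : Regime (frakGLatticeCLM (L := (L : ℝ)) (η := η) (lev₀ := lev₀) (Δ₁ := hessOp φ η U' τ)
          (Q := QtorusW L m hL φ U' hα1' hU1' hreg' (c₀ := c₀) (c₁ := c₁))
          φ hpos' hQ' lev₁ (nabla115 η U')) 0 W₂ B₀' θ' C₄' a₃' j' a' ε₄')
        (_hj : 0 ≤ j) (_hj' : 0 ≤ j') (B : NegSize (L : ℝ) η levB 0 𝔸)
        (_hB : ‖H1LatticeCLM (L := (L : ℝ)) (η := η) (lev₀ := lev₀) (levB := levB) φ hpos hQ lev₁ (nabla115 η U) B‖ < a)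
        (_hB' : ‖H1LatticeCLM (L := (L : ℝ)) (η := η) (lev₀ := lev₀) (levB := levB) (Δ₁ := hessOp φ η U' τ)
          (Q := QtorusW L m hL φ U' hα1' hU1' hreg' (c₀ := c₀) (c₁ := c₁))
          φ hpos' hQ' lev₁ (nabla115 η U') B‖ < a')
        (_hδW : ∀ P : Space115 (L : ℝ) η lev₀ lev₁ (nabla115 η U), ‖P‖ < ε₄ + a →
          ‖W₁ P - W₂ (LinearMap.toContinuousLinearMap
            ((jetLinearEquiv (L : ℝ) η lev₀ lev₁ (nabla115 η U')).symm.toLinearMap ∘ₗ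
              (jetLinearEquiv (L : ℝ) η lev₀ lev₁ (nabla115 η U)).toLinearMap) P)‖ ≤ δW)
        (_hρ₁ : (1 + Kι * δ) * (ε₄ + a) ≤ ρ) (_hρ₂ : ε₄' + a' ≤ ρ) (_hs : 0 < s) (_hdom : 2 * (ρ + s) ≤ a₃')
        (_hκ : θ' + 4 * B₀' * C₄' * (ρ + s) < 1)
        {b C₂c c₄ aC εC b' C₂c' c₄' aC' εC' δC ρC sC : ℝ}
        (_RC₁ : Regime (H1LatticeCLM (L := (L : ℝ)) (η := η) (lev₀ := lev₀) (levB := levB) φ hpos hQ lev₁ (nabla115 η U)) 0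
          (Cc L m η U lev₀ lev₁ (nabla115 η U) levB) b 0 C₂c c₄ 0 aC εC)
        (_RC₂ : Regime (H1LatticeCLM (L := (L : ℝ)) (η := η) (lev₀ := lev₀) (levB := levB) (Δ₁ := hessOp φ η U' τ)
          (Q := QtorusW L m hL φ U' hα1' hU1' hreg' (c₀ := c₀) (c₁ := c₁))
          φ hpos' hQ' lev₁ (nabla115 η U')) 0
          (Cc L m η U' lev₀ lev₁ (nabla115 η U') levB) b' 0 C₂c' c₄' 0 aC' εC')
        (_hcap : ε₄ + a ≤ aC) (_hcap' : ε₄' + a' ≤ aC')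
        (_hδC : ∀ P : Space115 (L : ℝ) η lev₀ lev₁ (nabla115 η U), ‖P‖ < εC + aC →
          ‖Cc L m η U lev₀ lev₁ (nabla115 η U) levB P - Cc L m η U' lev₀ lev₁ (nabla115 η U') levB
            (LinearMap.toContinuousLinearMap
              ((jetLinearEquiv (L : ℝ) η lev₀ lev₁ (nabla115 η U')).symm.toLinearMap ∘ₗ
                (jetLinearEquiv (L : ℝ) η lev₀ lev₁ (nabla115 η U)).toLinearMap) P)‖ ≤ δC)
        (_hρC₁ : (1 + Kι * δ) * (εC + aC) ≤ ρC) (_hρC₂ : εC' + aC' ≤ ρC) (_hsC : 0 < sC) (_hdomC : 2 * (ρC + sC) ≤ c₄')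
        (_hκC : 4 * b' * C₂c' * (ρC + sC) < 1),
      ‖LinearMap.toContinuousLinearMap
            ((jetLinearEquiv (L : ℝ) η lev₀ lev₁ (nabla115 η U')).symm.toLinearMap ∘ₗ
              (jetLinearEquiv (L : ℝ) η lev₀ lev₁ (nabla115 η U)).toLinearMap)
          (chartHB (frakGLatticeCLM (L := (L : ℝ)) (η := η) (lev₀ := lev₀) φ hpos hQ lev₁ (nabla115 η U)) 0 W₁ 0
            (fun A' => A' + solA (H1LatticeCLM (L := (L : ℝ)) (η := η) (lev₀ := lev₀) (levB := levB) φ hpos hQ lev₁ (nabla115 η U)) 0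
              (Cc L m η U lev₀ lev₁ (nabla115 η U) levB) 0 εC A') ε₄
            (H1LatticeCLM (L := (L : ℝ)) (η := η) (lev₀ := lev₀) (levB := levB) φ hpos hQ lev₁ (nabla115 η U)) B) -
        chartHB (frakGLatticeCLM (L := (L : ℝ)) (η := η) (lev₀ := lev₀) (Δ₁ := hessOp φ η U' τ)
              (Q := QtorusW L m hL φ U' hα1' hU1' hreg' (c₀ := c₀) (c₁ := c₁))
              φ hpos' hQ' lev₁ (nabla115 η U')) 0 W₂ 0
          (fun A' => A' + solA (H1LatticeCLM (L := (L : ℝ)) (η := η) (lev₀ := lev₀) (levB := levB) (Δ₁ := hessOp φ η U' τ)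
              (Q := QtorusW L m hL φ U' hα1' hU1' hreg' (c₀ := c₀) (c₁ := c₁))
              φ hpos' hQ' lev₁ (nabla115 η U')) 0
            (Cc L m η U' lev₀ lev₁ (nabla115 η U') levB) 0 εC' A') ε₄'
          (H1LatticeCLM (L := (L : ℝ)) (η := η) (lev₀ := lev₀) (levB := levB) (Δ₁ := hessOp φ η U' τ)
            (Q := QtorusW L m hL φ U' hα1' hU1' hreg' (c₀ := c₀) (c₁ := c₁))
            φ hpos' hQ' lev₁ (nabla115 η U')) B‖ ≤
        1 / (1 - 4 * b' * C₂c' * (ρC + sC)) *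
            ((KG * δ * (j + C₄ * (ε₄ + a) ^ 2) + 0 * (ε₄ + a) + B₀' * δW + KA * δ * ‖B‖) / (1 - (θ' + 4 * B₀' * C₄' * (ρ + s)))) +
          (KA * δ * (C₂c * (εC + aC) ^ 2) + b' * δC) / (1 - 4 * b' * C₂c' * (ρC + sC)) := by
  obtain ⟨KG, KA, ε₉, hKG, hKA, hε₉, H⟩ :=
    exists_letter_defects_twoBackgrounds L m hL φ (c₀ := c₀) (c₁ := c₁) (η := η) lev₀ levB lev₁ ha₀ hMφ hMφ' hφ hφ' τ hτ hCτ
  obtain ⟨Kι, hKιdef⟩ : ∃ Kι : ℝ, Kι = (NegSup.wSup (levWeight (L : ℝ) η lev₁ 2) : ℝ) * (2 * ‖((η : ℂ))⁻¹‖) *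
      NegSup.wInvSup (levWeight (L : ℝ) η lev₀ 1) + 1 := ⟨_, rfl⟩
  have hKι : 0 < Kι := by rw [hKιdef]; positivity
  refine ⟨KG, KA, Kι, ε₉, hKG, hKA, hKι, hε₉, ?_⟩
  intro U U' α α' hα1 hU1 hreg hα1' hU1' hreg' ε δ hε hεε₉ hδ hUε hU'ε hUU' hRS hRS' hpos hQ hpos' hQ' W₁ W₂ B₀ θ C₄ a₃ j a ε₄ B₀' θ' C₄' a₃' j' a' ε₄' δW ρ s R₁ R₂ hj hj' B hB hB'
    hδW hρ₁ hρ₂ hs hdom hκ b C₂c c₄ aC εC b' C₂c' c₄' aC' εC' δC ρC sC RC₁ RC₂ hcap hcap' hδC hρC₁ hρC₂ hsC hdomC hκC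
  obtain ⟨HG, HA⟩ := H U U' hα1 hU1 hreg hα1' hU1' hreg' hε hεε₉ hδ hUε hU'ε hUU' hRS hRS' hpos hQ hpos' hQ'
  have hUb : ∀ b : Bond d (fineP L m), U b ∈ U1 𝔸 := fun b => by
    obtain ⟨y, κ⟩ := b
    have h := hU1 (liftSite y) κ
    rwa [B9Eq315QTorus.perCfg_apply, perSite_liftSite] at h
  have hU'b : ∀ b : Bond d (fineP L m), U' b ∈ U1 𝔸 := fun b => by
    obtain ⟨y, κ⟩ := b
    have h := hU1' (liftSite y) κ
    rwa [B9Eq315QTorus.perCfg_apply, perSite_liftSite] at h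
  have hι : ∀ f : Space115 (L : ℝ) η lev₀ lev₁ (nabla115 η U),
      ‖LinearMap.toContinuousLinearMap
          ((jetLinearEquiv (L : ℝ) η lev₀ lev₁ (nabla115 η U')).symm.toLinearMap ∘ₗ
            (jetLinearEquiv (L : ℝ) η lev₀ lev₁ (nabla115 η U)).toLinearMap) f‖ ≤ (1 + Kι * δ) * ‖f‖ := fun f => by
    refine (norm_jetId_nabla_twoBackgrounds_le L m (η := η) (lev₀ := lev₀) lev₁ U U' hUb hU'b hδ hUU' f).trans
      (mul_le_mul_of_nonneg_right ?_ (norm_nonneg f))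
    rw [hKιdef]
    have h0 : 0 ≤ (NegSup.wSup (levWeight (L : ℝ) η lev₁ 2) : ℝ) * (2 * ‖((η : ℂ))⁻¹‖ * δ) * NegSup.wInvSup (levWeight (L : ℝ) η lev₀ 1) := by
      positivity
    nlinarith [h0, hδ]
  have hKAδ : 0 ≤ KA * δ := by positivity
  have h := norm_map_chartHB_sectC_sub_le R₁ R₂ RC₁ RC₂ hj hj' hB hB' hcap hcap' (by positivity) hι (by positivity) HG hδW hKAδ HA hδC
    hρ₁ hρ₂ hs hdom hκ hρC₁ hρC₂ hsC hdomC hκC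
  exact h

end Literature.MathematicalPhysics.QuantumFieldTheory.Balaban1983to89.B11Eq174ChartContinuityTwoBackgrounds

end
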